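import Mathlib.Analysis.InnerProductSpace.EuclideanDist
import Mathlib.Analysis.LocallyConvex.WithSeminorms
import Mathlib.Topology.Algebra.Module.LocallyConvex
import Mathlib.Topology.Connected.LocallyPathConnected
import Literature.AlgebraicGeometry.Motives.KaehlerTopology
import Literature.AlgebraicTopology.SingularHomology.FieldBaseChange
import Literature.AlgebraicTopology.SingularHomology.CompactManifoldFiniteness
import Literature.AlgebraicTopology.SingularHomology.CohomologyOfPoint
import Mathlib.Data.Finset.NatAntidiagonal
import Mathlib.Algebra.BigOperators.Group.Finset.Basic
import Literature.NumberTheory.Transcendental.DeRhamTheorem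
import Literature.NumberTheory.Transcendental.KaehlerHodge
import Literature.AlgebraicTopology.SingularHomology.BettiNumberBaseChange
import Literature.Geometry.Kaehler.KaehlerProofs
import Literature.AlgebraicTopology.SingularHomology.ExcisionMayerVietoris
import Literature.AlgebraicTopology.SingularHomology.CohomologyHomotopyInvariance
import Mathlib.Analysis.Convex.Contractible
import HarnessLib

/-!
# Topological consequences of the Kähler package: proofs (hard Lefschetz ⇒ `b_{2k} ≥ 1`)

Sibling proof file of `Literature/AlgebraicGeometry/Motives/KaehlerTopology.lean` (hodge.S14 and
its Betti-number corollaries). Sources: P. Griffiths, J. Harris, *Principles of Algebraic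
Geometry* (1978), p. 122; C. Voisin, *Hodge Theory and Complex Algebraic Geometry I* (2002),
Thm. 6.25 (hard Lefschetz, PDF pp. 125–126: "for every `k ≤ n`,
`L^{n-k} : H^k(X, ℝ) → H^{2n-k}(X, ℝ)` is an isomorphism"); D. Huybrechts, *Complex Geometry*
(2005), Prop. 3.3.13 (p. 162).

The named fact `Literature.AlgebraicGeometry.Motives.one_le_bettiNumber_two_mul_of_compactSpace`
("`b_{2k} ≥ 1` for `k ≤ n` on a compact connected Kähler manifold of complex dimension `n`";
until 2026-08-15 the compactness-free family `one_le_bettiNumber_two_mul`, retired, see the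
counterexamples below) is the printed corollary of the hard Lefschetz theorem: `Lⁿ : H⁰(M; ℝ) → H²ⁿ(M; ℝ)` is injective, `H⁰ ≠ 0`, hence
`Lᵏ : H⁰ → H²ᵏ` is injective for `k ≤ n` (`Lⁿ = Lⁿ⁻ᵏ ∘ Lᵏ`) and `κᵏ = Lᵏ 1 ≠ 0` in `H²ᵏ(M; ℝ)`,
so `b_{2k} ≥ 1`. Hard Lefschetz itself (hodge.S14; the Kähler identities / harmonic theory and
de Rham's theorem) is NOT proved in the tree: it is the named fact
`Literature.AlgebraicGeometry.Motives.hasHardLefschetzProperty_kaehlerClass` (identification form,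
`HodgeDecomposition.lean`), whose existence form at a compact `M : Type` — a class `κ ∈ H²(M; ℝ)`
with `Literature.Geometry.Kaehler.HasHardLefschetzProperty κ (finrank ℂ E)` — is derived from it
and de Rham's theorem in proofs file II, §3
(`exists_hasHardLefschetzProperty_of_hasHardLefschetzProperty_kaehlerClass`). This file PROVES
the topological ingredients of the reduction "hard Lefschetz class ⇒ `b_{2k} ≥ 1`", which is
assembled in proofs file III (`…KaehlerTopologyHardLefschetzProofs`:
`one_le_bettiNumber_two_mul_of_hasHardLefschetzProperty`, and from the two facts
`one_le_bettiNumber_two_mul_of_hasHardLefschetzProperty_kaehlerClass`). (Until 2026-08-15 the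
reduction was stated here as `one_le_bettiNumber_two_mul_of_exists_hasHardLefschetzProperty`,
with the existence-form named fact `exists_hasHardLefschetzProperty` of `KaehlerTopology.lean` as
hypothesis; that `def` was mis-stated — no compactness binder, see the counterexamples below — and
has been deleted, and the reduction moved to proofs file III with a hard Lefschetz class as datum.)
The ingredients, all proved:

* `injective_lefschetzPow_of_injective_add`: `Lⁱ⁺ʲ` injective ⇒ `Lⁱ` injective
  (`lefschetzPow_succ`, `Literature/Geometry/Kaehler/LefschetzOperator.lean`);
* `pathConnectedSpace_of_chartedSpace_of_connectedSpace`: a connected manifold modelled on a real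
  normed space is path connected (Mathlib: charted spaces over a locally path-connected model are
  locally path connected), whence `H⁰(M; ℝ) ≃ ℝ ≠ 0` by the tree's `singularCohomologyZeroEquiv`
  (Hatcher 2002, §3.1, p. 199);
* `finite_singularHomology_of_compactSpace_of_chartedSpace_normedSpace`: the homology of a compact
  Hausdorff space with an atlas on a finite-dimensional real normed space `F` is finitely
  generated — the tree's `finite_singularHomology_of_compact_chartedSpace` (Hatcher 2002, App. A,
  Cor. A.8–A.9, proved there by Wilder's method) after re-modelling `M` on
  `EuclideanSpace ℝ (Fin (finrank ℝ F))` through Mathlib's `toEuclidean` (`ChartedSpace.comp`);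
* `exists_ne_zero_of_hasHardLefschetzProperty`: a hard Lefschetz class on a connected `M` has
  non-zero powers `κᵏ = Lᵏ 1 ∈ H²ᵏ(M; ℝ)`, `k ≤ n`;
* (used in proofs file III) the passage from a non-zero class in `H²ᵏ(M; ℝ)` to
  `1 ≤ b_{2k}(M; ℚ)`: universal coefficients over `ℝ` and the field change `ℚ → ℝ`
  (`Literature.AlgebraicTopology.SingularHomology.one_le_bettiNumber_of_ne_zero_of_algebra`,
  Hatcher 2002, §3.1 Thm. 3.2 and §3.A Cor. 3A.4, file `…/SingularHomology/FieldBaseChange.lean`).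

Nothing is asserted: no new `def … : Prop`, no statement of `KaehlerTopology.lean` is modified.
Mathlib used: `toEuclidean`, `Homeomorph.toOpenPartialHomeomorph`,
`OpenPartialHomeomorph.singletonChartedSpace`, `ChartedSpace.comp`,
`ChartedSpace.locallyPathConnectedSpace`, `pathConnectedSpace_iff_connectedSpace`,
`LocallyConvexSpace.toLocallyPathConnectedSpace`.

## Odd Betti numbers are even (`even_bettiNumber_of_odd`, Voisin 2002 Cor. 6.13) — appended 2026-08-15

The named fact `Literature.AlgebraicGeometry.Motives.even_bettiNumber_of_odd` (Hodge 1941; Voisin,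
*Hodge Theory and Complex Algebraic Geometry I* (2002), §6.1.3, **Cor. 6.13** — in the held copy,
PDF p. 121, Cor. 6.12 is Hodge symmetry `\overline{H^{p,q}} = H^{q,p}` and Cor. 6.13 is "The odd
Betti numbers `b_{2k+1} = dim_ℂ H^{2k+1}(X, ℂ)` of a compact Kähler manifold are even"; the
docstring of the fact quotes "Cor. 6.12" for the pair) is reduced here to Hodge theory.

### The printed proof and what it rests on

Voisin's proof is one line: `b_{2k+1} = ∑_{p+q=2k+1} h^{p,q}` (Hodge decomposition) and
`h^{p,q} = h^{q,p}` (Hodge symmetry), so the summands pair off under `(p, q) ↦ (q, p)`, which has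
no fixed point on an odd antidiagonal. In the tree the three analytic inputs are **named facts
that are not yet discharged** (each is a theory of its own — harmonic forms and elliptic
regularity on compact manifolds, the Kähler identities, de Rham's theorem):

* `Literature.NumberTheory.Transcendental.sum_hodgeNumber_eq_finrank_complexDeRham g`
  (Hodge decomposition, numerically: `∑_{p+q=k} h^{p,q} = dim_ℂ H^k_dR(M; ℂ)` for a Kähler
  metric `g`; `KaehlerHodge.lean`);
* `Literature.NumberTheory.Transcendental.finrank_complexDeRham_eq_bettiNumber E M k`
  (de Rham's theorem with universal coefficients: `dim_ℂ H^k_dR(M; ℂ) = b_k(M; ℂ)`;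
  `DeRhamTheorem.lean`);
* `Literature.NumberTheory.Transcendental.hodgeNumber_symm g` (Hodge symmetry
  `h^{p,q} = h^{q,p}` for a Kähler metric `g`; `KaehlerHodge.lean`).

This file PROVES the remaining, elementary part of the argument:

* `even_sum_antidiagonal_of_symm`: a symmetric function summed over an odd antidiagonal of
  `ℕ × ℕ` gives an even number (the pairing `(p, q) ↦ (q, p)`);
* `even_bettiNumber_of_odd_of`: **the fact `even_bettiNumber_of_odd E` follows from the three
  named facts above**, for `M` in any universe (the facts used are the universe-polymorphic
  prelude ones, not the universe-`0` restatement
  `Literature.AlgebraicGeometry.Motives.sum_hodgeNumber_eq_bettiNumber` of `DeRhamComparison.lean`),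
  the passage from the rational Betti numbers `bettiNumber ℚ M k` of the fact to the complex ones
  of de Rham theory being the (proved) universal-coefficient comparison
  `Literature.AlgebraicTopology.SingularHomology.bettiNumber_eq_of_algebra ℚ ℂ`
  (`BettiNumberBaseChange.lean`).

### Scope of the fact: compactness (the original mis-statement and its correction)

As vendored until 2026-08-15, `even_bettiNumber_of_odd` was a `Prop`-valued family whose
elaborated binders were exactly
`(E : Type) [NormedAddCommGroup E] [NormedSpace ℂ E] [FiniteDimensional ℂ E] {M : Type u}
[TopologicalSpace M] [ChartedSpace E M] [IsManifold 𝓘(ℂ, E) ω M] [IsManifold 𝓘(ℝ, E) ∞ M]`: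
the section variables `[T2Space M] [CompactSpace M] [ConnectedSpace M]` of `KaehlerTopology.lean`
were **not** part of it, because a `def … : Prop` abstracts only the section variables its body
mentions (the very mechanism documented in the *Correction* note of
`Literature/Geometry/Kaehler/Kaehler.lean`). As a family it therefore asserted the evenness of the
odd Betti numbers of *every* complex manifold carrying a Kähler metric, which is false off the
compact world: the punctured plane `ℂ ∖ {0} ⊂ ℂ` with the flat metric is Kähler and has
`b₁ = 1` (`not_even_bettiNumber_of_odd_puncturedPlane`, `KaehlerTopologyPuncturedPlane.lean`,
proved; kept there in unfolded form as the record); the printed theorem (Voisin, Cor. 6.13) is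
about *compact* Kähler manifolds. The verdict clean-up (defact) pass of 2026-08-15 on
`KaehlerTopology.lean` restates the fact under the same name with `[T2Space M] [CompactSpace M]`
as instance binders *of the `def`* (body unchanged), so that it is only stated — and at a compact
Hausdorff `M` is definitionally the same `Prop` as before — where the theorem
`even_bettiNumber_of_odd_of` below proves it from the three facts it consumes (whose hypotheses
are `[T2Space M] [CompactSpace M]`): at every compact Hausdorff `M`, which is the printed result.
The sibling families of that file met the same accident (`bettiNumber_le_bettiNumber_add_two`,
`one_le_bettiNumber_two_mul`, and `exists_hasHardLefschetzProperty`, all false at the non-compact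
`M = ℂ`, see the counterexamples below) and were corrected under new names
(`…_of_compactSpace`) or merged, the false `def`s being deleted.

Consequently, for compact Hausdorff `M`, the instance `even_bettiNumber_of_odd E (M := M)` is
exactly as far away as the three facts: once `…_holds` theorems for them exist, it is the
one-liner `even_bettiNumber_of_odd_of (fun g ↦ sum_hodgeNumber_eq_finrank_complexDeRham_holds g)
(fun k ↦ finrank_complexDeRham_eq_bettiNumber_holds E M k) (fun g ↦ hodgeNumber_symm_holds g)`.
Nothing is asserted here; no new named fact is introduced (D-0026).

## The original facts of `KaehlerTopology.lean` were false as stated: formal counterexamples at `M = ℂ` — appended 2026-08-15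

The *Scope* remark above is not a matter of reading binders only: this section PROVES that three
of the four named facts of `KaehlerTopology.lean` as originally vendored (compactness an unused
section variable, hence not a binder of the `def`s), instantiated at the (non-compact) complex
plane `M = E = ℂ` — a complex manifold modelled on itself which *is* Kähler
(`Literature.Geometry.Kaehler.isKaehlerManifold_vectorSpace_holds`, the flat metric) — are false.
Each refutation is stated in **unfolded form** — verbatim the instance at `M = E = ℂ` of the body
of the former `def` — so that it survives the deletion of the false `def`s (the existence form
`exists_hasHardLefschetzProperty` by the D-0026 review, the two Betti families by the verdict
clean-up (defact) pass on `KaehlerTopology.lean`, both 2026-08-15) as the record of why: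

* `not_one_le_bettiNumber_two_mul_complexPlane :
    ¬ ∀ [IsKaehlerManifold ℂ ℂ] {k : ℕ}, k ≤ finrank ℂ ℂ → 1 ≤ b_{2k}(ℂ; ℚ)` — the instance at
  `M = E = ℂ` of the former family `one_le_bettiNumber_two_mul` (`k = 1 ≤ 1 = dim_ℂ ℂ` would give
  `1 ≤ b₂(ℂ; ℚ)`, but `b₂(ℂ) = 0`, `ℂ` being contractible);
* `not_bettiNumber_le_bettiNumber_add_two_complexPlane :
    ¬ ∀ [IsKaehlerManifold ℂ ℂ] {k : ℕ}, k < finrank ℂ ℂ → b_k(ℂ; ℚ) ≤ b_{k+2}(ℂ; ℚ)` — the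
  instance at `M = E = ℂ` of the former family `bettiNumber_le_bettiNumber_add_two` (`k = 0 < 1`:
  `b₀(ℂ) = 1 ≰ 0 = b₂(ℂ)`);
* `not_exists_hasHardLefschetzProperty_complexPlane :
    ¬ ∀ [IsKaehlerManifold ℂ ℂ], ∃ κ : H²(ℂ; ℝ), HasHardLefschetzProperty κ (finrank ℂ ℂ)` — the
  instance at `M = E = ℂ` of the former fact `exists_hasHardLefschetzProperty` (hodge.S14,
  metric-free existence form of hard Lefschetz, stated without compactness; in dimension `n = 1`
  the hard Lefschetz property asks `L¹ : H⁰(ℂ; ℝ) → H²(ℂ; ℝ)` to be bijective, but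
  `H⁰(ℂ; ℝ) ≃ ℝ ≠ 0 = H²(ℂ; ℝ)`).

Hence no `one_le_bettiNumber_two_mul_holds`, `bettiNumber_le_bettiNumber_add_two_holds` or
`exists_hasHardLefschetzProperty_holds` could ever have been proved; what is true (and printed:
Voisin 2002, Thm. 6.25 with Introduction Cor. 0.4; §3.1.3 Cor. 3.9) is their restriction to
compact `M` — for the Betti corollaries, re-vendored with the compactness classes as binders of
the `def` (`bettiNumber_le_bettiNumber_add_two_of_compactSpace`,
`one_le_bettiNumber_two_mul_of_compactSpace`, `KaehlerTopology.lean`); for hard Lefschetz, already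
the tree's identification-form fact `hasHardLefschetzProperty_kaehlerClass`, whence the existence
form at a compact `M : Type` is proved (proofs file II, §3), so that the false existence-form
`def` was deleted rather than restated (D-0026 review, 2026-08-15). The fourth fact,
`even_bettiNumber_of_odd`, survives the test space `ℂ` (all its positive-degree Betti numbers
vanish) and is refuted instead at the punctured plane `ℂ ∖ {0}` (`b₁ = 1`), a Kähler open
submanifold of `ℂ`: `not_even_bettiNumber_of_odd_puncturedPlane`, file
`KaehlerTopologyPuncturedPlane.lean` (that fact is restated under its name with the compactness
binders, see *Scope* above). Ingredients, all proved in the tree: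
contractible spaces have `b₀ = 1` and `bₙ = 0` for `n ≥ 1`
(`bettiNumber_zero_of_contractibleSpace`, `bettiNumber_eq_zero_of_contractibleSpace`, from
`singularHomology.isIso_ε_of_contractibleSpace` and `isZero_singularHomology_of_contractibleSpace`,
Hatcher 2002, Prop. 2.7–2.8 with Cor. 2.11), `Hⁿ(ℂ; ℝ) = Hⁿ(pt; ℝ) = 0` for `n ≥ 1`
(`singularCochainComplex.isZero_singularCohomology_of_subsingleton'`,
`singularCohomology.isoOfHomotopyEquiv'`, Hatcher §3.1 p. 199, p. 201) and `H⁰(ℂ; ℝ) ≃ ℝ`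
(`singularCohomologyZeroEquiv`).

## References

* P. Griffiths, J. Harris, *Principles of Algebraic Geometry*, Wiley 1978, p. 122.
  [GriffithsHarris1978]
* C. Voisin, *Hodge Theory and Complex Algebraic Geometry I*, CUP 2002, §6.2.3, Thm. 6.25,
  Cor. 6.26 (pp. 125–126, held). [Voisin2002]
* D. Huybrechts, *Complex Geometry*, Springer 2005, Prop. 3.3.13 (p. 162, held).
* A. Hatcher, *Algebraic Topology*, CUP 2002, §3.1 (p. 199, Thm. 3.2), §3.A (Cor. 3A.4), App. A
  (Cor. A.8–A.9). [HatcherAT2002]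
* W. V. D. Hodge, *The Theory and Applications of Harmonic Integrals*, CUP 1941, Ch. IV.
  [HodgeHarmonicIntegrals1941]
* C. Voisin, *Hodge Theory and Complex Algebraic Geometry I*, CUP 2002, §6.1.3, Cor. 6.12 (Hodge
  symmetry), Cor. 6.13 (odd Betti numbers are even; PDF p. 121, held). [VoisinHodgeI2002]
-/

noncomputable section

open scoped Manifold ContDiff
open CategoryTheory Limits Literature.AlgebraicTopology.SingularHomology Literature.Geometry.Kaehler

universe u v

namespace Literature.AlgebraicGeometry.Motives

/-! ### Iterates of the Lefschetz operator -/

section Lefschetz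

variable {X : Type u} [TopologicalSpace X] {R : Type v} [CommRing R]
  (κ : singularCohomology R R X 2)

/-- If the iterate `Lⁱ⁺ʲ = Lʲ ∘ Lⁱ : Hᵏ(X; R) → H^{k + 2(i+j)}(X; R)` of the Lefschetz operator of a
class `κ ∈ H²(X; R)` is injective then so is `Lⁱ : Hᵏ → H^{k + 2i}` (`Lʲ⁺¹ = L ∘ Lʲ`,
`lefschetzPow_succ`; Voisin 2002, §6.2.3; Griffiths–Harris 1978, p. 122: `Lⁿ⁻ᵏ` injective on
`Hᵏ` gives the injectivity of the lower iterates). [cite: Voisin2002, §6.2.3] -/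
theorem injective_lefschetzPow_of_injective_add (i j k : ℕ)
    (h : Function.Injective (lefschetzPow κ (i + j) k)) :
    Function.Injective (lefschetzPow κ i k) := by
  induction j with
  | zero => exact h
  | succ j ih =>
    refine ih ?_
    have h' : Function.Injective (lefschetzPow κ (i + j + 1) k) := h
    rw [lefschetzPow_succ, LinearMap.coe_comp] at h'
    exact h'.of_comp

/-- Under the hard Lefschetz property in dimension `n` (`Literature.Geometry.Kaehler.HasHardLefschetzProperty`:
`Lʲ : Hᵏ → H^{k+2j}` bijective for `k + j = n`), `Lᵏ : H⁰(X; R) → H²ᵏ(X; R)` is injective for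
every `k ≤ n` (`Lⁿ = Lⁿ⁻ᵏ ∘ Lᵏ` is bijective on `H⁰`). Voisin 2002, Thm. 6.25 / §6.2.3;
Griffiths–Harris 1978, p. 122. [cite: Voisin2002, §6.2.3] -/
theorem injective_lefschetzPow_zero_of_hasHardLefschetzProperty {n : ℕ}
    (hκ : HasHardLefschetzProperty κ n) {k : ℕ} (hk : k ≤ n) :
    Function.Injective (lefschetzPow κ k 0) := by
  obtain ⟨j, rfl⟩ := Nat.exists_eq_add_of_le hk
  exact injective_lefschetzPow_of_injective_add κ k j 0 (hκ (k + j) 0 (Nat.zero_add _)).1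

end Lefschetz

/-! ### Manifolds modelled on a real normed space: path connectedness, finiteness of homology -/

section Charted

/-- A connected space with an atlas modelled on a real normed space is path connected: normed
spaces are locally path connected (locally convex), charted spaces over a locally path-connected
model are locally path connected (`ChartedSpace.locallyPathConnectedSpace`), and locally
path-connected connected spaces are path connected (`pathConnectedSpace_iff_connectedSpace`).
The model `F` is an explicit argument (it cannot be inferred from the conclusion). [folklore] -/
theorem pathConnectedSpace_of_chartedSpace_of_connectedSpace (F : Type*) [NormedAddCommGroup F]
    [NormedSpace ℝ F] (M : Type u) [TopologicalSpace M] [ChartedSpace F M] [ConnectedSpace M] :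
    PathConnectedSpace M :=
  haveI := ChartedSpace.locallyPathConnectedSpace F M
  pathConnectedSpace_iff_connectedSpace.2 ‹_›

/-- **The singular homology of a compact manifold modelled on a finite-dimensional real normed
space is finitely generated** (Hatcher 2002, App. A, Cor. A.8 with Cor. A.9, p. 527), for every
Noetherian coefficient ring: the tree's `finite_singularHomology_of_compact_chartedSpace` (proved
by Wilder's method) after re-modelling `M` on `EuclideanSpace ℝ (Fin (finrank ℝ F))` along
Mathlib's continuous linear equivalence `toEuclidean : F ≃L[ℝ] EuclideanSpace ℝ (Fin (finrank ℝ F))`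
(`OpenPartialHomeomorph.singletonChartedSpace`, `ChartedSpace.comp`). The model `F` (explicit, any
universe) cannot be inferred from the conclusion. [cite: HatcherAT2002, App. A Cor. A.8 and A.9 p. 527] -/
theorem finite_singularHomology_of_compactSpace_of_chartedSpace_normedSpace (F : Type*)
    [NormedAddCommGroup F] [NormedSpace ℝ F] [FiniteDimensional ℝ F] (M : Type u)
    [TopologicalSpace M] [ChartedSpace F M] [CompactSpace M] [T2Space M] (R : Type v) [CommRing R]
    [IsNoetherianRing R] (k : ℕ) : Module.Finite R (singularHomology R R M k) := by
  letI : ChartedSpace (EuclideanSpace ℝ (Fin (Module.finrank ℝ F))) F :=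
    (toEuclidean (E := F)).toHomeomorph.toOpenPartialHomeomorph.singletonChartedSpace
      (by simp)
  letI : ChartedSpace (EuclideanSpace ℝ (Fin (Module.finrank ℝ F))) M :=
    ChartedSpace.comp (EuclideanSpace ℝ (Fin (Module.finrank ℝ F))) F M
  exact finite_singularHomology_of_compact_chartedSpace R R (d := Module.finrank ℝ F) k

/-- **A class with the hard Lefschetz property has non-zero powers `κᵏ ∈ H²ᵏ(M; ℝ)`, `k ≤ n`**,
on a connected space `M` with an atlas on a real normed space `F` (any `κ ∈ H²(M; ℝ)` with
`HasHardLefschetzProperty κ n`, any `n`): `H⁰(M; ℝ) ≃ ℝ` as `M` is path connected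
(`singularCohomologyZeroEquiv`, Hatcher 2002, §3.1, p. 199), and `Lᵏ : H⁰ → H²ᵏ` is injective
(`injective_lefschetzPow_zero_of_hasHardLefschetzProperty`), so `Lᵏ 1 ≠ 0`. The degree is
spelled `0 + 2 * k`, the target degree of `lefschetzPow κ k 0`; `F` is explicit. Voisin 2002,
§6.2.3; Griffiths–Harris 1978, p. 122 (`Lᵏ` injective on `H⁰`, so the powers of the Kähler
class are non-zero). [cite: GriffithsHarris1978, p. 122] -/
theorem exists_ne_zero_of_hasHardLefschetzProperty (F : Type*) [NormedAddCommGroup F]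
    [NormedSpace ℝ F] {M : Type u} [TopologicalSpace M] [ChartedSpace F M] [ConnectedSpace M]
    (κ : singularCohomology ℝ ℝ M 2) {n : ℕ} (hκ : HasHardLefschetzProperty κ n) {k : ℕ}
    (hk : k ≤ n) : ∃ a : singularCohomology ℝ ℝ M (0 + 2 * k), a ≠ 0 := by
  haveI : PathConnectedSpace M := pathConnectedSpace_of_chartedSpace_of_connectedSpace F M
  have h1 : (singularCohomologyZeroEquiv ℝ ℝ M).symm 1 ≠ 0 :=
    (singularCohomologyZeroEquiv ℝ ℝ M).symm.map_ne_zero_iff.2 one_ne_zero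
  exact ⟨lefschetzPow κ k 0 ((singularCohomologyZeroEquiv ℝ ℝ M).symm 1),
    (map_ne_zero_iff _ (injective_lefschetzPow_zero_of_hasHardLefschetzProperty κ hκ hk)).2 h1⟩

end Charted

/-! ### The pairing `(p, q) ↦ (q, p)` on an odd antidiagonal -/

open Finset in
/-- **A symmetric function has even sum over an odd antidiagonal.** If `k` is odd and
`h p q = h q p` whenever `p + q = k`, then `∑_{p+q=k} h p q` is even: no `(p, q)` with
`p + q = k` has `p = q`, so the antidiagonal splits into `{p < q}` and its mirror image
`{q < p}` under `(p, q) ↦ (q, p)`, on which `h` takes the same values. This is the counting step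
of Voisin (2002), Cor. 6.13 (`b_{2k+1} = ∑_{p+q=2k+1} h^{p,q} = 2 ∑_{p<q} h^{p,q}`). PROVED.
[cite: VoisinHodgeI2002, §6.1.3 Cor. 6.13] -/
theorem even_sum_antidiagonal_of_symm {k : ℕ} (hk : Odd k) (h : ℕ → ℕ → ℕ)
    (hsymm : ∀ p q, p + q = k → h p q = h q p) :
    Even (∑ pq ∈ antidiagonal k, h pq.1 pq.2) := by
  rw [← sum_filter_add_sum_filter_not (antidiagonal k) (fun pq ↦ pq.1 < pq.2)]
  suffices hswap : ∑ pq ∈ (antidiagonal k).filter (fun pq ↦ ¬pq.1 < pq.2), h pq.1 pq.2 =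
      ∑ pq ∈ (antidiagonal k).filter (fun pq ↦ pq.1 < pq.2), h pq.1 pq.2 by
    rw [hswap]
    exact ⟨_, rfl⟩
  refine sum_nbij' Prod.swap Prod.swap (fun pq hpq ↦ ?_) (fun pq hpq ↦ ?_) (fun _ _ ↦ rfl)
    (fun _ _ ↦ rfl) (fun pq hpq ↦ ?_)
  · simp only [mem_filter, mem_antidiagonal, not_lt] at hpq ⊢
    refine ⟨by rw [Prod.fst_swap, Prod.snd_swap, add_comm, hpq.1], ?_⟩
    rcases hpq.2.lt_or_eq with hlt | heq
    · exact hlt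
    · exact absurd ⟨pq.1, by rw [← hpq.1, heq]⟩ (Nat.not_even_iff_odd.mpr hk)
  · simp only [mem_filter, mem_antidiagonal, not_lt] at hpq ⊢
    exact ⟨by rw [Prod.fst_swap, Prod.snd_swap, add_comm, hpq.1], hpq.2.le⟩
  · exact hsymm _ _ (mem_antidiagonal.mp (mem_filter.mp hpq).1)

/-! ### `even_bettiNumber_of_odd` from Hodge decomposition, de Rham and Hodge symmetry -/

section HodgeSymmetry

variable {E : Type} [NormedAddCommGroup E] [NormedSpace ℂ E] [FiniteDimensional ℂ E]
variable {M : Type u} [TopologicalSpace M] [ChartedSpace E M] [IsManifold 𝓘(ℂ, E) ω M]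
  [IsManifold 𝓘(ℝ, E) ∞ M] [T2Space M] [CompactSpace M]

open Finset in
/-- **Odd Betti numbers of a compact Kähler manifold are even, granted Hodge theory** (Hodge
1941; Voisin (2002), §6.1.3, Cor. 6.13; Griffiths–Harris (1978), p. 117): the named fact
`even_bettiNumber_of_odd E` (for `M`) follows from
(i) the numerical Hodge decomposition `∑_{p+q=k} h^{p,q}(M) = dim_ℂ H^k_dR(M; ℂ)` for every
smooth Kähler metric (`Literature.NumberTheory.Transcendental.sum_hodgeNumber_eq_finrank_complexDeRham`),
(ii) de Rham's theorem `dim_ℂ H^k_dR(M; ℂ) = b_k(M; ℂ)`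
(`Literature.NumberTheory.Transcendental.finrank_complexDeRham_eq_bettiNumber`), and
(iii) Hodge symmetry `h^{p,q} = h^{q,p}` (`Literature.NumberTheory.Transcendental.hodgeNumber_symm`),
the three named facts threaded as hypotheses (the interim, conditional form of the discharge
`even_bettiNumber_of_odd_holds`). Proof as printed in Voisin: pick a Kähler metric `g`
(`IsKaehlerManifold.exists_isKaehler`); `b_k(M; ℚ) = b_k(M; ℂ)` (universal coefficients over a
field, `Literature.AlgebraicTopology.SingularHomology.bettiNumber_eq_of_algebra`, proved)
`= dim_ℂ H^k_dR(M; ℂ) = ∑_{p+q=k} h^{p,q}`, which for odd `k` is even by the symmetry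
(`even_sum_antidiagonal_of_symm`). PROVED (conditional on (i)–(iii) as hypotheses).
[cite: VoisinHodgeI2002, §6.1.3 Cor. 6.13] -/
theorem even_bettiNumber_of_odd_of
    (hH : ∀ g : Bundle.ContMDiffRiemannianMetric 𝓘(ℝ, E) ∞ E
      (fun x : M ↦ TangentSpace 𝓘(ℝ, E) x),
      Literature.NumberTheory.Transcendental.sum_hodgeNumber_eq_finrank_complexDeRham g)
    (hdR : ∀ k, Literature.NumberTheory.Transcendental.finrank_complexDeRham_eq_bettiNumber E M k)
    (hS : ∀ g : Bundle.ContMDiffRiemannianMetric 𝓘(ℝ, E) ∞ E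
      (fun x : M ↦ TangentSpace 𝓘(ℝ, E) x),
      Literature.NumberTheory.Transcendental.hodgeNumber_symm g) :
    even_bettiNumber_of_odd E (M := M) := by
  intro _ k hk
  obtain ⟨g, hg⟩ := Literature.Geometry.Kaehler.IsKaehlerManifold.exists_isKaehler (E := E) (M := M)
  rw [Literature.AlgebraicTopology.SingularHomology.bettiNumber_eq_of_algebra ℚ ℂ M k,
    ← show Module.finrank ℂ (Literature.NumberTheory.Transcendental.complexDeRhamCohomology E M k) =
        Literature.AlgebraicTopology.SingularHomology.bettiNumber ℂ M k from hdR k,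
    ← show ∑ pq ∈ antidiagonal k, Literature.NumberTheory.Transcendental.hodgeNumber E M pq.1 pq.2 =
        Module.finrank ℂ (Literature.NumberTheory.Transcendental.complexDeRhamCohomology E M k)
      from hH g hg k]
  exact even_sum_antidiagonal_of_symm hk _ fun p q _ ↦ hS g hg p q

end HodgeSymmetry

/-! ### The facts of `KaehlerTopology.lean` are false off the compact world: `M = ℂ` -/

section Counterexamples

/-- A contractible space has vanishing Betti numbers in positive degrees, `bₙ(X; K) = 0` for
`n ≥ 1` (Hatcher 2002, §2.1, Prop. 2.8 with Cor. 2.11: `Hₙ(X) = 0`; here from the tree's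
`isZero_singularHomology_of_contractibleSpace`). [cite: HatcherAT2002, §2.1 Prop. 2.8 and Cor. 2.11] -/
theorem bettiNumber_eq_zero_of_contractibleSpace (K : Type v) [Field K] (X : Type u)
    [TopologicalSpace X] [ContractibleSpace X] {n : ℕ} (hn : n ≠ 0) : bettiNumber K X n = 0 := by
  haveI : Subsingleton (singularHomology K K X n) :=
    ModuleCat.isZero_iff_subsingleton.mp (isZero_singularHomology_of_contractibleSpace K K hn)
  exact Module.finrank_zero_of_subsingleton

/-- A contractible space has `b₀(X; K) = 1` (Hatcher 2002, §2.1, Prop. 2.7 with Cor. 2.11: the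
augmentation `ε : H₀(X; K) → K` is an isomorphism for a non-empty path-connected space; here from
the tree's `singularHomology.isIso_ε_of_contractibleSpace`). [cite: HatcherAT2002, §2.1 Prop. 2.7 and Cor. 2.11] -/
theorem bettiNumber_zero_of_contractibleSpace (K : Type v) [Field K] (X : Type u)
    [TopologicalSpace X] [ContractibleSpace X] : bettiNumber K X 0 = 1 := by
  haveI := singularHomology.isIso_ε_of_contractibleSpace K K (X := X)
  have e : singularHomology K K X 0 ≃ₗ[K] ULift.{u} K :=
    (asIso (singularHomology.ε K K X)).toLinearEquiv
  change Module.finrank K (singularHomology K K X 0) = 1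
  rw [e.finrank_eq, ULift.moduleEquiv.finrank_eq, Module.finrank_self]

/-- **The former family `one_le_bettiNumber_two_mul` ("`1 ≤ b_{2k}` for `k ≤ n`", vendored
without a compactness binder) is false as stated**: at the complex plane `M = E = ℂ`, a Kähler
manifold (`isKaehlerManifold_vectorSpace_holds`) of complex dimension `1`, it asserts
`1 ≤ b₂(ℂ; ℚ)` (`k = 1 ≤ 1`), whereas `b₂(ℂ; ℚ) = 0` since `ℂ` is contractible. The statement is,
verbatim, the instance at `M = E = ℂ` of the body of that former `def` of `KaehlerTopology.lean`,
kept unfolded as the record of why it was retired (verdict clean-up, 2026-08-15). The printed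
statement (Voisin 2002, §3.1.3 Cor. 3.9; Griffiths–Harris 1978, p. 122) is about compact Kähler
manifolds, and in that form it is the tree's `one_le_bettiNumber_two_mul_of_compactSpace`.
[folklore] -/
theorem not_one_le_bettiNumber_two_mul_complexPlane :
    ¬ ∀ [IsKaehlerManifold ℂ ℂ] {k : ℕ}, k ≤ Module.finrank ℂ ℂ → 1 ≤ bettiNumber ℚ ℂ (2 * k) := by
  intro h
  haveI : IsKaehlerManifold ℂ ℂ := isKaehlerManifold_vectorSpace_holds ℂ
  have h1 : 1 ≤ bettiNumber ℚ ℂ (2 * 1) := h (k := 1) (by rw [Module.finrank_self])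
  rw [bettiNumber_eq_zero_of_contractibleSpace ℚ ℂ (by norm_num)] at h1
  exact Nat.not_succ_le_zero 0 h1

/-- **The former family `bettiNumber_le_bettiNumber_add_two` ("`b_k ≤ b_{k+2}` for `k < n`",
vendored without a compactness binder) is false as stated**: at the complex plane `M = E = ℂ`
(Kähler, complex dimension `1`) it asserts, for `k = 0 < 1`, `b₀(ℂ; ℚ) ≤ b₂(ℂ; ℚ)`, whereas
`b₀(ℂ) = 1` and `b₂(ℂ) = 0` (`ℂ` is contractible). The statement is, verbatim, the instance at
`M = E = ℂ` of the body of that former `def` of `KaehlerTopology.lean`, kept unfolded as the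
record of why it was retired (verdict clean-up, 2026-08-15). The printed statement (Voisin 2002,
Introduction Cor. 0.4 of Thm. 0.3 = Thm. 6.25; Griffiths–Harris 1978, p. 122) is about compact
Kähler manifolds, and in that form it is the tree's
`bettiNumber_le_bettiNumber_add_two_of_compactSpace`. [folklore] -/
theorem not_bettiNumber_le_bettiNumber_add_two_complexPlane :
    ¬ ∀ [IsKaehlerManifold ℂ ℂ] {k : ℕ}, k < Module.finrank ℂ ℂ →
      bettiNumber ℚ ℂ k ≤ bettiNumber ℚ ℂ (k + 2) := by
  intro h
  haveI : IsKaehlerManifold ℂ ℂ := isKaehlerManifold_vectorSpace_holds ℂ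
  have h1 : bettiNumber ℚ ℂ 0 ≤ bettiNumber ℚ ℂ (0 + 2) :=
    h (k := 0) (by rw [Module.finrank_self]; exact Nat.zero_lt_one)
  rw [bettiNumber_zero_of_contractibleSpace ℚ ℂ,
    bettiNumber_eq_zero_of_contractibleSpace ℚ ℂ (by norm_num)] at h1
  exact Nat.not_succ_le_zero 0 h1

/-- **The metric-free existence form of hard Lefschetz (hodge.S14) is false without
compactness**: at the complex plane `M = E = ℂ` — a Kähler manifold
(`isKaehlerManifold_vectorSpace_holds`, the flat metric) of complex dimension `n = 1` — there is
no `κ ∈ H²(ℂ; ℝ)` with `L¹ = (κ ⌣ -) : H⁰(ℂ; ℝ) → H²(ℂ; ℝ)` bijective (`k = 0`, `j = 1`,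
`k + j = n`): `H²(ℂ; ℝ) ≅ H²(pt; ℝ) = 0` (`ℂ` is contractible; homotopy invariance of singular
cohomology, Hatcher 2002, §3.1, p. 201, and `Hⁿ(pt) = 0` for `n > 0`, p. 199) while
`H⁰(ℂ; ℝ) ≃ ℝ ≠ 0` (`singularCohomologyZeroEquiv`), so `L¹` is not injective. The statement is,
verbatim, the instance at `M = E = ℂ` of the body of the former named fact
`exists_hasHardLefschetzProperty` of `KaehlerTopology.lean`, which omitted the compactness binder
and was therefore deleted (D-0026 review, 2026-08-15); this refutation is kept, unfolded, as the
record of why. The printed theorem (Voisin 2002, Thm. 6.25; Griffiths–Harris 1978, p. 122) is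
about compact Kähler manifolds, and in that form it is the tree's
`hasHardLefschetzProperty_kaehlerClass` (`HodgeDecomposition.lean`). [folklore] -/
theorem not_exists_hasHardLefschetzProperty_complexPlane :
    ¬ ∀ [IsKaehlerManifold ℂ ℂ], ∃ κ : singularCohomology ℝ ℝ ℂ 2,
      HasHardLefschetzProperty κ (Module.finrank ℂ ℂ) := by
  intro h
  haveI : IsKaehlerManifold ℂ ℂ := isKaehlerManifold_vectorSpace_holds ℂ
  obtain ⟨κ, hκ⟩ := (h : ∃ κ : singularCohomology ℝ ℝ ℂ 2,
    HasHardLefschetzProperty κ (Module.finrank ℂ ℂ))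
  have hbij : Function.Bijective (lefschetzPow κ 1 0) := hκ 1 0 (by rw [Module.finrank_self])
  -- `H^{0 + 2·1}(ℂ; ℝ) ≅ H²(pt; ℝ) = 0`
  obtain ⟨e⟩ := ContractibleSpace.hequiv ℂ PUnit.{1}
  have hz : IsZero (singularCohomology ℝ ℝ ℂ (0 + 2 * 1)) :=
    (singularCochainComplex.isZero_singularCohomology_of_subsingleton' (R := ℝ) (M := ℝ)
      (X := PUnit.{1}) (by norm_num)).of_iso
      (singularCohomology.isoOfHomotopyEquiv' ℝ ℝ e (0 + 2 * 1)).symm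
  haveI : Subsingleton (singularCohomology ℝ ℝ ℂ (0 + 2 * 1)) :=
    ModuleCat.isZero_iff_subsingleton.mp hz
  -- but `H⁰(ℂ; ℝ) ≃ ℝ` has a non-zero element, which `L¹` cannot map injectively into `0`
  have h1 : (singularCohomologyZeroEquiv ℝ ℝ ℂ).symm 1 ≠ 0 :=
    (singularCohomologyZeroEquiv ℝ ℝ ℂ).symm.map_ne_zero_iff.2 one_ne_zero
  exact h1 (hbij.1 (Subsingleton.elim _ _))

end Counterexamples


end Literature.AlgebraicGeometry.Motives
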